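import Summits.HodgeConjecture.CorCM.Census.CentralSquaresNearLatticePow
import Summits.HodgeConjecture.CorCM.Census.CentralSquaresFourTypeLaw

/-!
# The square-central class, XXVIII: translates of the near classes and the residual closure UP TO `4` of the order-`4` swap rows

COR-CM (cell `pub-hodgecm2`), count-neutral kernel combinatorics by the binder seat b09 (gen 46; lane SQUARE-CENTRAL CLASS, part XXVIII), on parts II/XXIV
(`residual_closure_four_pow`), VIII (`residual_cases` bookkeeping) and the base-change calculus (`rt_oflipCM`, `oflipCM_rt_self`) BY NAME.  Theorems only:
no definition, no `decide`, no certificate, no named fact, no `sorry`.  HONEST FRAMING: `HC_CM` is NOT proved, here or anywhere in the tree; nothing here is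
a period or a headline.

Notation (`e₀ = [T₀]`, `e₁ = [T₁]`, `f_s = [T₀^{(s)}]`, `g_s = [T₁^{(s)}]`): `Y_s = (f_s − e₀) + (g_s − e₁)`, `Y'_s = (f_s − e₀) − (g_s − e₁)`.
* §1 TRANSLATES: along `u` with `T₀·u⁻¹ = T₁`, `T₁·u⁻¹ = T₀` (a base-involutive swap): `Y_s·u⁻¹ = Y_{s u⁻¹}`, `Y'_s·u⁻¹ = −Y'_{s u⁻¹}`
  (`mapDomain_rt_Y_of_swap`, `mapDomain_rt_Y'_of_swap`); along `u` with `T₀·u⁻¹ = T₀`, `T₁·u⁻¹ = T̄₁` (the stabiliser `g₁` of the order-`4` rows):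
  `Y_s·u⁻¹ = Y'_{s u⁻¹} + (pair T₁^{(su⁻¹)} − pair T₁)`, `Y'_s·u⁻¹ = Y_{s u⁻¹} − (pair T₁^{(su⁻¹)} − pair T₁)` (`mapDomain_rt_Y_of_stab`, `mapDomain_rt_Y'_of_stab`);
  along `u` stabilising both (`mapDomain_rt_Y_of_stab_stab`, `mapDomain_rt_Y'_of_stab_stab`).
* §2 `four_smul_mem_of_relations`: the LINEAR ALGEBRA of the order-`4` rows — from the six translates of part XXVIIʼs relation
  (`Y_{h₁} − Y'_{κ₁}`, `Y_{h₂} − Y'_{κ₂}`, `Y_{h₂} − Y'_{κ₁}`, `Y_{t₁} + Y'_{a₁}`, `Y_{t₂} + Y'_{a₂}`, `Y_{t₂} + Y'_{a₁}`) and the two transversal differences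
  (`Y_{t₁} + Y_{t₂} − Y_{h₁} − Y_{h₂} = R(T) − R(𝓗∖T)`, `Y'_{a₁} + Y'_{a₂} − Y'_{κ₁} − Y'_{κ₂} = Rᶜ(A) − Rᶜ(𝓗ᶜ∖A)`): `4Y_s, 4Y'_s ∈ L` for all eight
  places (NOT `2Y`: the quotient is `ℤ/4 × ℤ/2`, design note `CENTRAL-SQUARES-M2.md` §5).
* §3 `residual_closure_frame_four`: `4Y_s` (`s ∈ 𝓗`), `4Y'_s` (`s ∈ 𝓗ᶜ`), one `R(T)`, one `Rᶜ(T')`, pairs ⟹ `2²·y ∈ L` for every residual Hodge vector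
  `y` of the base block of `T₀` (part XXIV + part VIIIʼs residual bookkeeping).

## References
* [Pohlmann1968] H. Pohlmann, Algebraic cycles on abelian varieties of complex multiplication type, Ann. of Math. 88 (1968), Thm 1.
-/

namespace Summit.HodgeConjecture.CorCM.Census.CentralSquares

open Finset
open scoped symmDiff
open Summit.HodgeConjecture.CorCM.Prior.AllgGroup.RfwfAllgGroup
open Summit.HodgeConjecture.CorCM.Census.BlockParity
open Summit.HodgeConjecture.CorCM.Census.Coinvariant
open Summit.HodgeConjecture.CorCM.Census.TwistGeneration
open Summit.HodgeConjecture.CorCM.Census.BaseBlock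

noncomputable section

variable {G : Type*} [Group G] [Fintype G] [DecidableEq G] (c : G)

section Translates

variable (hc2 : c * c = 1) (hcen : ∀ x : G, x * c = c * x) (T₀ T₁ : CMF G c)

/-! ## §1 Translates of the near classes -/

/-- **`Y_s·u⁻¹ = Y_{su⁻¹}`** along a base-involutive swap `u` (`T₀·u⁻¹ = T₁`, `T₁·u⁻¹ = T₀`). [folklore] -/
theorem mapDomain_rt_Y_of_swap (u : G) (hu₀ : rt c u T₀ = T₁) (hu₁ : rt c u T₁ = T₀) (s : G) :
    Finsupp.mapDomain (rt c u) ((Finsupp.single (oflipCM c hc2 s T₀) (1 : ℤ) - Finsupp.single T₀ 1) +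
      (Finsupp.single (oflipCM c hc2 s T₁) (1 : ℤ) - Finsupp.single T₁ 1)) =
      (Finsupp.single (oflipCM c hc2 (s * u⁻¹) T₀) (1 : ℤ) - Finsupp.single T₀ 1) +
        (Finsupp.single (oflipCM c hc2 (s * u⁻¹) T₁) (1 : ℤ) - Finsupp.single T₁ 1) := by
  rw [Finsupp.mapDomain_add, Finsupp.mapDomain_sub, Finsupp.mapDomain_sub, Finsupp.mapDomain_single, Finsupp.mapDomain_single,
    Finsupp.mapDomain_single, Finsupp.mapDomain_single, rt_oflipCM, rt_oflipCM, hu₀, hu₁]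
  abel

/-- **`Y'_s·u⁻¹ = −Y'_{su⁻¹}`** along a base-involutive swap `u`. [folklore] -/
theorem mapDomain_rt_Y'_of_swap (u : G) (hu₀ : rt c u T₀ = T₁) (hu₁ : rt c u T₁ = T₀) (s : G) :
    Finsupp.mapDomain (rt c u) ((Finsupp.single (oflipCM c hc2 s T₀) (1 : ℤ) - Finsupp.single T₀ 1) -
      (Finsupp.single (oflipCM c hc2 s T₁) (1 : ℤ) - Finsupp.single T₁ 1)) =
      -((Finsupp.single (oflipCM c hc2 (s * u⁻¹) T₀) (1 : ℤ) - Finsupp.single T₀ 1) -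
        (Finsupp.single (oflipCM c hc2 (s * u⁻¹) T₁) (1 : ℤ) - Finsupp.single T₁ 1)) := by
  rw [Finsupp.mapDomain_sub, Finsupp.mapDomain_sub, Finsupp.mapDomain_sub, Finsupp.mapDomain_single, Finsupp.mapDomain_single,
    Finsupp.mapDomain_single, Finsupp.mapDomain_single, rt_oflipCM, rt_oflipCM, hu₀, hu₁]
  abel

include hcen in
/-- **`Y_s·u⁻¹ = Y'_{su⁻¹} + (pair T₁^{(su⁻¹)} − pair T₁)`** along `u` with `T₀·u⁻¹ = T₀`, `T₁·u⁻¹ = T̄₁`. [folklore] -/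
theorem mapDomain_rt_Y_of_stab (u : G) (hu₀ : rt c u T₀ = T₀) (hu₁ : rt c u T₁ = rt c c T₁) (s : G) :
    Finsupp.mapDomain (rt c u) ((Finsupp.single (oflipCM c hc2 s T₀) (1 : ℤ) - Finsupp.single T₀ 1) +
      (Finsupp.single (oflipCM c hc2 s T₁) (1 : ℤ) - Finsupp.single T₁ 1)) =
      ((Finsupp.single (oflipCM c hc2 (s * u⁻¹) T₀) (1 : ℤ) - Finsupp.single T₀ 1) -
        (Finsupp.single (oflipCM c hc2 (s * u⁻¹) T₁) (1 : ℤ) - Finsupp.single T₁ 1)) +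
      (pair c (oflipCM c hc2 (s * u⁻¹) T₁) - pair c T₁) := by
  have hsr : ∀ X : CMF G c, Finsupp.single (rt c c X) (1 : ℤ) = pair c X - Finsupp.single X 1 := fun X => by
    rw [pair, add_sub_cancel_left]
  simp only [Finsupp.mapDomain_add, Finsupp.mapDomain_sub, Finsupp.mapDomain_single, rt_oflipCM, hu₀, hu₁]
  simp only [oflipCM_rt_self c hc2 hcen, hsr]
  abel

include hcen in
/-- **`Y'_s·u⁻¹ = Y_{su⁻¹} − (pair T₁^{(su⁻¹)} − pair T₁)`** along `u` with `T₀·u⁻¹ = T₀`, `T₁·u⁻¹ = T̄₁`. [folklore] -/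
theorem mapDomain_rt_Y'_of_stab (u : G) (hu₀ : rt c u T₀ = T₀) (hu₁ : rt c u T₁ = rt c c T₁) (s : G) :
    Finsupp.mapDomain (rt c u) ((Finsupp.single (oflipCM c hc2 s T₀) (1 : ℤ) - Finsupp.single T₀ 1) -
      (Finsupp.single (oflipCM c hc2 s T₁) (1 : ℤ) - Finsupp.single T₁ 1)) =
      ((Finsupp.single (oflipCM c hc2 (s * u⁻¹) T₀) (1 : ℤ) - Finsupp.single T₀ 1) +
        (Finsupp.single (oflipCM c hc2 (s * u⁻¹) T₁) (1 : ℤ) - Finsupp.single T₁ 1)) -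
      (pair c (oflipCM c hc2 (s * u⁻¹) T₁) - pair c T₁) := by
  have hsr : ∀ X : CMF G c, Finsupp.single (rt c c X) (1 : ℤ) = pair c X - Finsupp.single X 1 := fun X => by
    rw [pair, add_sub_cancel_left]
  simp only [Finsupp.mapDomain_sub, Finsupp.mapDomain_single, rt_oflipCM, hu₀, hu₁]
  simp only [oflipCM_rt_self c hc2 hcen, hsr]
  abel

/-- **`Y_s·u⁻¹ = Y_{su⁻¹}`** along `u` stabilising `T₀` and `T₁`. [folklore] -/
theorem mapDomain_rt_Y_of_stab_stab (u : G) (hu₀ : rt c u T₀ = T₀) (hu₁ : rt c u T₁ = T₁) (s : G) :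
    Finsupp.mapDomain (rt c u) ((Finsupp.single (oflipCM c hc2 s T₀) (1 : ℤ) - Finsupp.single T₀ 1) +
      (Finsupp.single (oflipCM c hc2 s T₁) (1 : ℤ) - Finsupp.single T₁ 1)) =
      (Finsupp.single (oflipCM c hc2 (s * u⁻¹) T₀) (1 : ℤ) - Finsupp.single T₀ 1) +
        (Finsupp.single (oflipCM c hc2 (s * u⁻¹) T₁) (1 : ℤ) - Finsupp.single T₁ 1) := by
  simp only [Finsupp.mapDomain_add, Finsupp.mapDomain_sub, Finsupp.mapDomain_single, rt_oflipCM, hu₀, hu₁]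

/-- **`Y'_s·u⁻¹ = Y'_{su⁻¹}`** along `u` stabilising `T₀` and `T₁`. [folklore] -/
theorem mapDomain_rt_Y'_of_stab_stab (u : G) (hu₀ : rt c u T₀ = T₀) (hu₁ : rt c u T₁ = T₁) (s : G) :
    Finsupp.mapDomain (rt c u) ((Finsupp.single (oflipCM c hc2 s T₀) (1 : ℤ) - Finsupp.single T₀ 1) -
      (Finsupp.single (oflipCM c hc2 s T₁) (1 : ℤ) - Finsupp.single T₁ 1)) =
      (Finsupp.single (oflipCM c hc2 (s * u⁻¹) T₀) (1 : ℤ) - Finsupp.single T₀ 1) -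
        (Finsupp.single (oflipCM c hc2 (s * u⁻¹) T₁) (1 : ℤ) - Finsupp.single T₁ 1) := by
  simp only [Finsupp.mapDomain_sub, Finsupp.mapDomain_single, rt_oflipCM, hu₀, hu₁]

/-! ## §2 The linear algebra: `4Y`, `4Y'` from six translates and two transversal differences -/

/-- **`4Y_s, 4Y'_s ∈ L` FROM THE SIX TRANSLATES AND THE TWO TRANSVERSAL DIFFERENCES.**  With `Y_s`, `Y'_s` as above and eight place elements
`h₁, h₂, t₁, t₂` (for `𝓗`) and `κ₁, κ₂, a₁, a₂` (for `𝓗ᶜ`): if `L` contains `Y_{h₁} − Y'_{κ₁}`, `Y_{h₂} − Y'_{κ₂}`, `Y_{h₂} − Y'_{κ₁}`, `Y_{t₁} + Y'_{a₁}`,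
`Y_{t₂} + Y'_{a₂}`, `Y_{t₂} + Y'_{a₁}`, `Y_{t₁} + Y_{t₂} − Y_{h₁} − Y_{h₂}` and `Y'_{a₁} + Y'_{a₂} − Y'_{κ₁} − Y'_{κ₂}`, then it contains `4Y_s` for
`s ∈ {h₁, h₂, t₁, t₂}` and `4Y'_s` for `s ∈ {κ₁, κ₂, a₁, a₂}`. [folklore] -/
theorem four_smul_mem_of_relations (L : Submodule ℤ (CMF G c →₀ ℤ)) (h₁ h₂ t₁ t₂ κ₁ κ₂ a₁ a₂ : G)
    (r1 : ((Finsupp.single (oflipCM c hc2 h₁ T₀) (1 : ℤ) - Finsupp.single T₀ 1) + (Finsupp.single (oflipCM c hc2 h₁ T₁) (1 : ℤ) - Finsupp.single T₁ 1)) -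
      ((Finsupp.single (oflipCM c hc2 κ₁ T₀) (1 : ℤ) - Finsupp.single T₀ 1) - (Finsupp.single (oflipCM c hc2 κ₁ T₁) (1 : ℤ) - Finsupp.single T₁ 1)) ∈ L)
    (r2 : ((Finsupp.single (oflipCM c hc2 h₂ T₀) (1 : ℤ) - Finsupp.single T₀ 1) + (Finsupp.single (oflipCM c hc2 h₂ T₁) (1 : ℤ) - Finsupp.single T₁ 1)) -
      ((Finsupp.single (oflipCM c hc2 κ₂ T₀) (1 : ℤ) - Finsupp.single T₀ 1) - (Finsupp.single (oflipCM c hc2 κ₂ T₁) (1 : ℤ) - Finsupp.single T₁ 1)) ∈ L)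
    (r3 : ((Finsupp.single (oflipCM c hc2 h₂ T₀) (1 : ℤ) - Finsupp.single T₀ 1) + (Finsupp.single (oflipCM c hc2 h₂ T₁) (1 : ℤ) - Finsupp.single T₁ 1)) -
      ((Finsupp.single (oflipCM c hc2 κ₁ T₀) (1 : ℤ) - Finsupp.single T₀ 1) - (Finsupp.single (oflipCM c hc2 κ₁ T₁) (1 : ℤ) - Finsupp.single T₁ 1)) ∈ L)
    (r4 : ((Finsupp.single (oflipCM c hc2 t₁ T₀) (1 : ℤ) - Finsupp.single T₀ 1) + (Finsupp.single (oflipCM c hc2 t₁ T₁) (1 : ℤ) - Finsupp.single T₁ 1)) +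
      ((Finsupp.single (oflipCM c hc2 a₁ T₀) (1 : ℤ) - Finsupp.single T₀ 1) - (Finsupp.single (oflipCM c hc2 a₁ T₁) (1 : ℤ) - Finsupp.single T₁ 1)) ∈ L)
    (r5 : ((Finsupp.single (oflipCM c hc2 t₂ T₀) (1 : ℤ) - Finsupp.single T₀ 1) + (Finsupp.single (oflipCM c hc2 t₂ T₁) (1 : ℤ) - Finsupp.single T₁ 1)) +
      ((Finsupp.single (oflipCM c hc2 a₂ T₀) (1 : ℤ) - Finsupp.single T₀ 1) - (Finsupp.single (oflipCM c hc2 a₂ T₁) (1 : ℤ) - Finsupp.single T₁ 1)) ∈ L)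
    (r6 : ((Finsupp.single (oflipCM c hc2 t₂ T₀) (1 : ℤ) - Finsupp.single T₀ 1) + (Finsupp.single (oflipCM c hc2 t₂ T₁) (1 : ℤ) - Finsupp.single T₁ 1)) +
      ((Finsupp.single (oflipCM c hc2 a₁ T₀) (1 : ℤ) - Finsupp.single T₀ 1) - (Finsupp.single (oflipCM c hc2 a₁ T₁) (1 : ℤ) - Finsupp.single T₁ 1)) ∈ L)
    (r7 : ((Finsupp.single (oflipCM c hc2 t₁ T₀) (1 : ℤ) - Finsupp.single T₀ 1) + (Finsupp.single (oflipCM c hc2 t₁ T₁) (1 : ℤ) - Finsupp.single T₁ 1)) +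
      ((Finsupp.single (oflipCM c hc2 t₂ T₀) (1 : ℤ) - Finsupp.single T₀ 1) + (Finsupp.single (oflipCM c hc2 t₂ T₁) (1 : ℤ) - Finsupp.single T₁ 1)) -
      ((Finsupp.single (oflipCM c hc2 h₁ T₀) (1 : ℤ) - Finsupp.single T₀ 1) + (Finsupp.single (oflipCM c hc2 h₁ T₁) (1 : ℤ) - Finsupp.single T₁ 1)) -
      ((Finsupp.single (oflipCM c hc2 h₂ T₀) (1 : ℤ) - Finsupp.single T₀ 1) + (Finsupp.single (oflipCM c hc2 h₂ T₁) (1 : ℤ) - Finsupp.single T₁ 1)) ∈ L)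
    (r8 : ((Finsupp.single (oflipCM c hc2 a₁ T₀) (1 : ℤ) - Finsupp.single T₀ 1) - (Finsupp.single (oflipCM c hc2 a₁ T₁) (1 : ℤ) - Finsupp.single T₁ 1)) +
      ((Finsupp.single (oflipCM c hc2 a₂ T₀) (1 : ℤ) - Finsupp.single T₀ 1) - (Finsupp.single (oflipCM c hc2 a₂ T₁) (1 : ℤ) - Finsupp.single T₁ 1)) -
      ((Finsupp.single (oflipCM c hc2 κ₁ T₀) (1 : ℤ) - Finsupp.single T₀ 1) - (Finsupp.single (oflipCM c hc2 κ₁ T₁) (1 : ℤ) - Finsupp.single T₁ 1)) -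
      ((Finsupp.single (oflipCM c hc2 κ₂ T₀) (1 : ℤ) - Finsupp.single T₀ 1) - (Finsupp.single (oflipCM c hc2 κ₂ T₁) (1 : ℤ) - Finsupp.single T₁ 1)) ∈ L) :
    (∀ s ∈ ({h₁, h₂, t₁, t₂} : Finset G), (4 : ℤ) • ((Finsupp.single (oflipCM c hc2 s T₀) (1 : ℤ) - Finsupp.single T₀ 1) +
      (Finsupp.single (oflipCM c hc2 s T₁) (1 : ℤ) - Finsupp.single T₁ 1)) ∈ L) ∧
    (∀ s ∈ ({κ₁, κ₂, a₁, a₂} : Finset G), (4 : ℤ) • ((Finsupp.single (oflipCM c hc2 s T₀) (1 : ℤ) - Finsupp.single T₀ 1) -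
      (Finsupp.single (oflipCM c hc2 s T₁) (1 : ℤ) - Finsupp.single T₁ 1)) ∈ L) := by
  set Y : G → (CMF G c →₀ ℤ) := fun s => (Finsupp.single (oflipCM c hc2 s T₀) (1 : ℤ) - Finsupp.single T₀ 1) +
      (Finsupp.single (oflipCM c hc2 s T₁) (1 : ℤ) - Finsupp.single T₁ 1) with hY
  set Y' : G → (CMF G c →₀ ℤ) := fun s => (Finsupp.single (oflipCM c hc2 s T₀) (1 : ℤ) - Finsupp.single T₀ 1) -
      (Finsupp.single (oflipCM c hc2 s T₁) (1 : ℤ) - Finsupp.single T₁ 1) with hY'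
  change Y h₁ - Y' κ₁ ∈ L at r1
  change Y h₂ - Y' κ₂ ∈ L at r2
  change Y h₂ - Y' κ₁ ∈ L at r3
  change Y t₁ + Y' a₁ ∈ L at r4
  change Y t₂ + Y' a₂ ∈ L at r5
  change Y t₂ + Y' a₁ ∈ L at r6
  change Y t₁ + Y t₂ - Y h₁ - Y h₂ ∈ L at r7
  change Y' a₁ + Y' a₂ - Y' κ₁ - Y' κ₂ ∈ L at r8
  change (∀ s ∈ ({h₁, h₂, t₁, t₂} : Finset G), (4 : ℤ) • Y s ∈ L) ∧ (∀ s ∈ ({κ₁, κ₂, a₁, a₂} : Finset G), (4 : ℤ) • Y' s ∈ L)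
  -- `u = Y h₁`, `v = Y t₁`: `2v − 2u ∈ L` and `−2v − 2u ∈ L`
  have hA : (2 : ℤ) • Y t₁ - (2 : ℤ) • Y h₁ ∈ L := by
    have e : (2 : ℤ) • Y t₁ - (2 : ℤ) • Y h₁ = (Y t₁ + Y t₂ - Y h₁ - Y h₂) - (Y t₂ + Y' a₁) + (Y t₁ + Y' a₁) + (Y h₂ - Y' κ₁) - (Y h₁ - Y' κ₁) := by
      module
    rw [e]; exact Submodule.sub_mem _ (Submodule.add_mem _ (Submodule.add_mem _ (Submodule.sub_mem _ r7 r6) r4) r3) r1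
  have hB : -((2 : ℤ) • Y t₁) - (2 : ℤ) • Y h₁ ∈ L := by
    have e : -((2 : ℤ) • Y t₁) - (2 : ℤ) • Y h₁ = (Y' a₁ + Y' a₂ - Y' κ₁ - Y' κ₂) - (Y t₁ + Y' a₁) - (Y t₂ + Y' a₂) + (Y t₂ + Y' a₁) - (Y t₁ + Y' a₁)
        - (Y h₁ - Y' κ₁) - (Y h₂ - Y' κ₂) + (Y h₂ - Y' κ₁) - (Y h₁ - Y' κ₁) + ((2 : ℤ) • (Y t₁ + Y' a₁) - (2 : ℤ) • (Y t₁ + Y' a₁)) := by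
      module
    rw [e]
    exact Submodule.add_mem _ (Submodule.sub_mem _ (Submodule.add_mem _ (Submodule.sub_mem _ (Submodule.sub_mem _ (Submodule.sub_mem _
      (Submodule.add_mem _ (Submodule.sub_mem _ (Submodule.sub_mem _ r8 r4) r5) r6) r4) r1) r2) r3) r1)
      (Submodule.sub_mem _ (Submodule.smul_mem _ _ r4) (Submodule.smul_mem _ _ r4))
  have hu : (4 : ℤ) • Y h₁ ∈ L := by
    have e : (4 : ℤ) • Y h₁ = -((2 : ℤ) • Y t₁ - (2 : ℤ) • Y h₁) - (-((2 : ℤ) • Y t₁) - (2 : ℤ) • Y h₁) := by module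
    rw [e]; exact Submodule.sub_mem _ (Submodule.neg_mem _ hA) hB
  have hv : (4 : ℤ) • Y t₁ ∈ L := by
    have e : (4 : ℤ) • Y t₁ = ((2 : ℤ) • Y t₁ - (2 : ℤ) • Y h₁) - (-((2 : ℤ) • Y t₁) - (2 : ℤ) • Y h₁) := by module
    rw [e]; exact Submodule.sub_mem _ hA hB
  have hh₂ : (4 : ℤ) • Y h₂ ∈ L := by
    have e : (4 : ℤ) • Y h₂ = (4 : ℤ) • Y h₁ + (4 : ℤ) • (Y h₂ - Y' κ₁) - (4 : ℤ) • (Y h₁ - Y' κ₁) := by module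
    rw [e]; exact Submodule.sub_mem _ (Submodule.add_mem _ hu (Submodule.smul_mem _ _ r3)) (Submodule.smul_mem _ _ r1)
  have ht₂ : (4 : ℤ) • Y t₂ ∈ L := by
    have e : (4 : ℤ) • Y t₂ = (4 : ℤ) • Y t₁ + (4 : ℤ) • (Y t₂ + Y' a₁) - (4 : ℤ) • (Y t₁ + Y' a₁) := by module
    rw [e]; exact Submodule.sub_mem _ (Submodule.add_mem _ hv (Submodule.smul_mem _ _ r6)) (Submodule.smul_mem _ _ r4)
  have hκ₁ : (4 : ℤ) • Y' κ₁ ∈ L := by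
    have e : (4 : ℤ) • Y' κ₁ = (4 : ℤ) • Y h₁ - (4 : ℤ) • (Y h₁ - Y' κ₁) := by module
    rw [e]; exact Submodule.sub_mem _ hu (Submodule.smul_mem _ _ r1)
  have hκ₂ : (4 : ℤ) • Y' κ₂ ∈ L := by
    have e : (4 : ℤ) • Y' κ₂ = (4 : ℤ) • Y h₂ - (4 : ℤ) • (Y h₂ - Y' κ₂) := by module
    rw [e]; exact Submodule.sub_mem _ hh₂ (Submodule.smul_mem _ _ r2)
  have ha₁ : (4 : ℤ) • Y' a₁ ∈ L := by
    have e : (4 : ℤ) • Y' a₁ = (4 : ℤ) • (Y t₁ + Y' a₁) - (4 : ℤ) • Y t₁ := by module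
    rw [e]; exact Submodule.sub_mem _ (Submodule.smul_mem _ _ r4) hv
  have ha₂ : (4 : ℤ) • Y' a₂ ∈ L := by
    have e : (4 : ℤ) • Y' a₂ = (4 : ℤ) • (Y t₂ + Y' a₂) - (4 : ℤ) • Y t₂ := by module
    rw [e]; exact Submodule.sub_mem _ (Submodule.smul_mem _ _ r5) ht₂
  constructor
  · intro s hs
    simp only [mem_insert, mem_singleton] at hs
    rcases hs with rfl | rfl | rfl | rfl
    · exact hu
    · exact hh₂
    · exact hv
    · exact ht₂
  · intro s hs
    simp only [mem_insert, mem_singleton] at hs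
    rcases hs with rfl | rfl | rfl | rfl
    · exact hκ₁
    · exact hκ₂
    · exact ha₁
    · exact ha₂

end Translates

/-! ## §3 Residual closure of the base block up to `4` -/

/-- **RESIDUAL CLOSURE UP TO `4` IN THE FRAME.**  Central involution `c ≠ 1`; base types `T₀`, `T₁` with base block `{T₀, T̄₀, T₁, T̄₁}`,
`|T₀ ∖ T₁| = |T₀ ∩ T₁| = 2m`; a lattice `L ∋` all pairs with `4Y_s ∈ L` (`s ∈ T₀ ∖ T₁`), `4Y'_s ∈ L` (`s ∈ T₀ ∩ T₁`), one `R(T)` and one `Rᶜ(T')`.  Then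
`2²·y ∈ L` for every Hodge vector `y` supported on types of potential `≤ 1`. [folklore] -/
theorem residual_closure_frame_four (hc2 : c * c = 1) (hc1 : c ≠ 1) (hcen : ∀ x : G, x * c = c * x) (T₀ T₁ : CMF G c)
    (hbase : ∀ Q : G, rt c Q T₀ = T₀ ∨ rt c Q T₀ = rt c c T₀ ∨ rt c Q T₀ = T₁ ∨ rt c Q T₀ = rt c c T₁)
    (L : Submodule ℤ (CMF G c →₀ ℤ)) (hP : ∀ Ψ : CMF G c, pair c Ψ ∈ L) (m : ℕ)
    (hH : (T₀.1 \ T₁.1).card = 2 * m) (hHc : (T₀.1 ∩ T₁.1).card = 2 * m)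
    (h4Y : ∀ s ∈ T₀.1 \ T₁.1, (4 : ℤ) • ((Finsupp.single (oflipCM c hc2 s T₀) (1 : ℤ) - Finsupp.single T₀ 1) +
      (Finsupp.single (oflipCM c hc2 s T₁) (1 : ℤ) - Finsupp.single T₁ 1)) ∈ L)
    (h4Y' : ∀ s ∈ T₀.1 ∩ T₁.1, (4 : ℤ) • ((Finsupp.single (oflipCM c hc2 s T₀) (1 : ℤ) - Finsupp.single T₀ 1) -
      (Finsupp.single (oflipCM c hc2 s T₁) (1 : ℤ) - Finsupp.single T₁ 1)) ∈ L)
    (hR : ∃ T : Finset G, T ⊆ T₀.1 \ T₁.1 ∧ T.card = m ∧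
      ∑ s ∈ T, Finsupp.single (oflipCM c hc2 s T₀) (1 : ℤ) - ∑ u ∈ (T₀.1 \ T₁.1) \ T, Finsupp.single (oflipCM c hc2 u T₁) (1 : ℤ) -
        ((m : ℤ) - 1) • (Finsupp.single T₀ (1 : ℤ) - Finsupp.single T₁ 1) ∈ L)
    (hRc : ∃ T' : Finset G, T' ⊆ T₀.1 ∩ T₁.1 ∧ T'.card = m ∧
      ∑ s ∈ T', Finsupp.single (oflipCM c hc2 s T₀) (1 : ℤ) + ∑ u ∈ (T₀.1 ∩ T₁.1) \ T', Finsupp.single (oflipCM c hc2 u T₁) (1 : ℤ) -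
        ((m : ℤ) - 1) • (Finsupp.single T₀ (1 : ℤ) + Finsupp.single T₁ 1) ∈ L) :
    ∀ y ∈ hodgeSpan c hc2, (∀ Ψ ∈ y.support, bpot c T₀ Ψ ≤ 1) → ((2 : ℤ) ^ 2) • y ∈ L := by
  have h4 : ((2 : ℤ) ^ 2) = 4 := by norm_num
  have hclose := residual_closure_four_pow c hc2 hc1 hcen T₀ T₁ L hP 2 m hH hHc
    (fun s hs => by rw [h4]; exact h4Y s hs) (fun s hs => by rw [h4]; exact h4Y' s hs) hR hRc
  intro y hy hyR
  refine hclose y hy fun Ψ hΨ => ?_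
  rcases residual_cases c T₀ hc2 (hyR Ψ hΨ) with ⟨Q', rfl⟩ | ⟨Q', s, -, rfl⟩
  · rcases hbase Q' with h | h | h | h
    · exact Or.inl h
    · exact Or.inr (Or.inr (Or.inl h))
    · exact Or.inr (Or.inl h)
    · exact Or.inr (Or.inr (Or.inr (Or.inl h)))
  · right; right; right; right
    refine ⟨s * Q'⁻¹, ?_⟩
    rw [rt_oflipCM]
    rcases hbase Q' with h | h | h | h <;> rw [h]
    · exact Or.inl rfl
    · exact Or.inr (Or.inr (Or.inl rfl))
    · exact Or.inr (Or.inl rfl)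
    · exact Or.inr (Or.inr (Or.inr rfl))

end

end Summit.HodgeConjecture.CorCM.Census.CentralSquares
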